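import Summits.CriticalPhenomena.PercolationContinuityZ3.Theorems.PercNearOneGluingNoHeavyLowerTailSahiCTCLadderThreeRowTwoDense
import Summits.CriticalPhenomena.PercolationContinuityZ3.Theorems.PercNearOneGluingNoHeavyLowerTailSahiCTCLadderRowOneTFacts
import HarnessLib

/-!
# `NoHeavyLowerTail` (crux stmt-CriticalPhenomena-4575), P3 lane: the row `#dbl = 2` of the ladder `(L_t)`, all `t` — cubes and charge

Support file (seat `prim-l12-p3`, gen 26; `--supports stmt-CriticalPhenomena-4575`).  Memo g26 §4.16.  For every level `t ≥ 2` and a profile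
`m = 2·1_d + 2·1_{d'} + 1_T` (`#dbl m = 2`, `τ = #T`): the cubes of `[m](e_t·H)` are the restrictions `κ(∅, D ∪ T∖Y)` (`#Y = t−2`), the
links `κ({d'}, d ∪ T∖Q)` (`#Q = t−1`, both orientations) and the double links `κ(D, T∖E)` (`#E = t`) (`cubes_le_coeff_ee_mul_harris_rowTwoT`);
the charge is at most `cH(t,τ−t+4)·a + cH(t−1,τ−t+2)·(q_d+q_{d'}) + cH(t−2,τ−t)·ε` (`coeff_chargeT_rowTwoT_le`), and the common `t`-sets of a
restriction cube split by their pattern on `D` into the four charged kinds (`card_kinds_le_csetsT`, `card_pinned_kinds_le`,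
`card_unpinned_kinds_le`).  Nothing is asserted about the crux.
-/

namespace Summit.CriticalPhenomena.PercolationContinuityZ3.Theorems.SahiCTCForms

open Finset MvPolynomial SahiCTCGenFun SahiCTCWeightedLYM

variable {α : Type*} [DecidableEq α] [Fintype α]

section RowTwoT
variable {𝒳 𝒵 : Finset (Finset α)}

/-- **Cubes of the row `#dbl = 2` of `(L_t)`** (`t ≥ 2`). [this work] -/
theorem cubes_le_coeff_ee_mul_harris_rowTwoT (h𝒳 : IsUpperSet (𝒳 : Set (Finset α))) (h𝒵 : IsUpperSet (𝒵 : Set (Finset α)))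
    {t : ℕ} (ht : 2 ≤ t) {m : α →₀ ℕ} (hm : ∀ i, m i ≤ 2) (hD : #(dbl m) = 2) :
    ∑ Y ∈ (lev m 1).powersetCard (t - 2), kap 𝒳 𝒵 ∅ (dbl m ∪ (lev m 1 \ Y)) +
      ∑ d ∈ dbl m, ∑ Q ∈ (lev m 1).powersetCard (t - 1), kapL1 𝒳 𝒵 m d Q +
      ∑ E ∈ (lev m 1).powersetCard t, kap 𝒳 𝒵 (dbl m) (lev m 1 \ E) ≤
      (ee t * (PiP * gf (𝒳 ∩ 𝒵) - gf 𝒳 * gf 𝒵)).coeff m := by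
  unfold kapL1
  have hDT : Disjoint (dbl m) (lev m 1) := disjoint_dbl_lev_one m
  set S₀ := ((lev m 1).powersetCard (t - 2)).image fun Y => dbl m ∪ Y
  set S₁ := (dbl m ×ˢ (lev m 1).powersetCard (t - 1)).image fun q => insert q.1 q.2
  set S₂ := (lev m 1).powersetCard t
  have hcardD : ∀ E, (E ∈ S₀ → #(dbl m ∩ E) = 2) ∧ (E ∈ S₁ → #(dbl m ∩ E) = 1) ∧ (E ∈ S₂ → #(dbl m ∩ E) = 0) := fun E => by
    refine ⟨fun h => ?_, fun h => ?_, fun h => ?_⟩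
    · obtain ⟨Y, hY, rfl⟩ := mem_image.1 h
      rw [inter_union_distrib_left, inter_self, disjoint_iff_inter_eq_empty.1 (hDT.mono_right (mem_powersetCard.1 hY).1),
        union_empty, hD]
    · obtain ⟨q, hq, rfl⟩ := mem_image.1 h
      obtain ⟨hq1, hq2⟩ := mem_product.1 hq
      rw [inter_insert_of_mem hq1, disjoint_iff_inter_eq_empty.1 (hDT.mono_right (mem_powersetCard.1 hq2).1), insert_empty_eq,
        card_singleton]
    · rw [disjoint_iff_inter_eq_empty.1 (hDT.mono_right (mem_powersetCard.1 h).1), card_empty]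
  have hadm : S₀ ∪ S₁ ∪ S₂ ⊆ (bySize (· = t) : Finset (Finset α)).filter fun E => ind E ≤ m := by
    intro E hE
    rw [mem_filter, bySize, mem_filter, SahiAllButC.ind_le_iff_subset_support, support_eq_dbl_union_lev hm]
    refine ⟨⟨mem_powerset.2 (subset_univ _), ?_⟩, ?_⟩
    · rcases mem_union.1 hE with hE | hE
      · rcases mem_union.1 hE with hE | hE
        · obtain ⟨Y, hY, rfl⟩ := mem_image.1 hE
          rw [card_union_of_disjoint (hDT.mono_right (mem_powersetCard.1 hY).1), hD, (mem_powersetCard.1 hY).2]; omega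
        · obtain ⟨q, hq, rfl⟩ := mem_image.1 hE
          obtain ⟨hq1, hq2⟩ := mem_product.1 hq
          rw [card_insert_of_notMem (fun h => disjoint_left.1 hDT hq1 ((mem_powersetCard.1 hq2).1 h)), (mem_powersetCard.1 hq2).2]
          omega
      · exact (mem_powersetCard.1 hE).2
    · rcases mem_union.1 hE with hE | hE
      · rcases mem_union.1 hE with hE | hE
        · obtain ⟨Y, hY, rfl⟩ := mem_image.1 hE
          exact union_subset_union Subset.rfl (mem_powersetCard.1 hY).1
        · obtain ⟨q, hq, rfl⟩ := mem_image.1 hE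
          obtain ⟨hq1, hq2⟩ := mem_product.1 hq
          exact insert_subset (mem_union_left _ hq1) ((mem_powersetCard.1 hq2).1.trans subset_union_right)
      · exact (mem_powersetCard.1 hE).1.trans subset_union_right
  have hd01 : Disjoint S₀ S₁ := disjoint_left.2 fun E h0 h1 => by
    have := (hcardD E).1 h0; have := (hcardD E).2.1 h1; omega
  have hd2 : Disjoint (S₀ ∪ S₁) S₂ := disjoint_left.2 fun E h h2 => by
    have h2' := (hcardD E).2.2 h2
    rcases mem_union.1 h with h | h
    · have := (hcardD E).1 h; omega
    · have := (hcardD E).2.1 h; omega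
  have hinj₀ : Set.InjOn (fun Y : Finset α => dbl m ∪ Y) ↑((lev m 1).powersetCard (t - 2)) := fun Y hY Y' hY' h => by
    have hY := (mem_powersetCard.1 (Finset.mem_coe.1 hY)).1
    have hY' := (mem_powersetCard.1 (Finset.mem_coe.1 hY')).1
    have e : (dbl m ∪ Y) \ dbl m = (dbl m ∪ Y') \ dbl m := by rw [show dbl m ∪ Y = dbl m ∪ Y' from h]
    rwa [union_sdiff_left, union_sdiff_left, sdiff_eq_self_of_disjoint (hDT.symm.mono_left hY),
      sdiff_eq_self_of_disjoint (hDT.symm.mono_left hY')] at e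
  have hinj₁ : Set.InjOn (fun q : α × Finset α => insert q.1 q.2) ↑(dbl m ×ˢ (lev m 1).powersetCard (t - 1)) := by
    intro q hq q' hq' h
    obtain ⟨hq1, hq2⟩ := mem_product.1 (Finset.mem_coe.1 hq)
    obtain ⟨hq1', hq2'⟩ := mem_product.1 (Finset.mem_coe.1 hq')
    have hQ := (mem_powersetCard.1 hq2).1
    have hQ' := (mem_powersetCard.1 hq2').1
    have h' : insert q.1 q.2 = insert q'.1 q'.2 := h
    have hx : q.1 = q'.1 := by
      have e : dbl m ∩ insert q.1 q.2 = dbl m ∩ insert q'.1 q'.2 := by rw [h']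
      rw [inter_insert_of_mem hq1, inter_insert_of_mem hq1', disjoint_iff_inter_eq_empty.1 (hDT.mono_right hQ),
        disjoint_iff_inter_eq_empty.1 (hDT.mono_right hQ'), insert_empty_eq, insert_empty_eq] at e
      exact singleton_injective e
    have hQQ : q.2 = q'.2 := by
      have e : (insert q.1 q.2).erase q.1 = (insert q'.1 q'.2).erase q.1 := by rw [h']
      rwa [erase_insert (fun h => disjoint_left.1 hDT hq1 (hQ h)), hx,
        erase_insert (fun h => disjoint_left.1 hDT hq1' (hQ' h))] at e
    exact Prod.ext hx hQQ
  have hsur := sum_le_coeff_ee_mul_harris h𝒳 h𝒵 t m hadm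
  rw [sum_union hd2, sum_union hd01, sum_image hinj₀, sum_image hinj₁,
    sum_congr rfl fun Y hY => coeff_harris_cube_rowTwo_R hm (mem_powersetCard.1 hY).1,
    sum_congr rfl fun q hq => coeff_harris_cube_L1 hm (mem_product.1 hq).1 (mem_powersetCard.1 (mem_product.1 hq).2).1,
    sum_congr rfl fun E hE => coeff_harris_cube_rowTwo_L hm (mem_powersetCard.1 hE).1, sum_product] at hsur
  exact hsur

omit [Fintype α] in
/-- `#{w : 1_w ≤ m, #(D ∩ w) = 2} ≤ #{Y ⊆ T : #Y = t − 2, D ∪ Y ∈ W}` (two doubled points, `t`-sets). [this work] -/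
theorem card_WC2_le_T {t : ℕ} {m : α →₀ ℕ} (hm : ∀ i, m i ≤ 2) (hD : #(dbl m) = 2) (W : Finset (Finset α)) (hW : ∀ w ∈ W, #w = t) :
    #((W.filter fun w => ind w ≤ m).filter fun w => #(dbl m ∩ w) = 2) ≤
      #(((lev m 1).powersetCard (t - 2)).filter fun Y => dbl m ∪ Y ∈ W) := by
  refine card_le_card_of_injOn (fun w => w \ dbl m) (fun w hw => ?_) (fun w hw w' hw' h => ?_)
  · obtain ⟨hw', hDw⟩ := mem_filter.1 (Finset.mem_coe.1 hw)
    obtain ⟨hwW, hwm⟩ := mem_filter.1 hw'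
    have hwsupp : w ⊆ dbl m ∪ lev m 1 := support_eq_dbl_union_lev hm ▸ (SahiAllButC.ind_le_iff_subset_support _ _).1 hwm
    have hDsub : dbl m ⊆ w := by
      have : dbl m ∩ w = dbl m := eq_of_subset_of_card_le inter_subset_left (by rw [hDw, hD])
      exact fun i hi => (mem_inter.1 (this.symm ▸ hi)).2
    refine Finset.mem_coe.2 (mem_filter.2 ⟨mem_powersetCard.2 ⟨fun y hy => ?_, ?_⟩, ?_⟩)
    · exact (mem_union.1 (hwsupp (mem_sdiff.1 hy).1)).resolve_left (mem_sdiff.1 hy).2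
    · show #(w \ dbl m) = t - 2
      have := card_sdiff_add_card_inter w (dbl m); rw [inter_comm, hDw, hW w hwW] at this; omega
    · rw [union_sdiff_of_subset hDsub]; exact hwW
  · have hsub : ∀ w'' ∈ ((W.filter fun w => ind w ≤ m).filter fun w => #(dbl m ∩ w) = 2), dbl m ⊆ w'' := fun w'' hw'' => by
      obtain ⟨_, hDw⟩ := mem_filter.1 hw''
      have : dbl m ∩ w'' = dbl m := eq_of_subset_of_card_le inter_subset_left (by rw [hDw, hD])
      exact fun i hi => (mem_inter.1 (this.symm ▸ hi)).2
    have h' : w \ dbl m = w' \ dbl m := h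
    rw [← union_sdiff_of_subset (hsub w (Finset.mem_coe.1 hw)), h', union_sdiff_of_subset (hsub w' (Finset.mem_coe.1 hw'))]

omit [Fintype α] in
/-- `#{w : 1_w ≤ m, #(D ∩ w) = 1} ≤ Σ_{d ∈ D} #{Q ⊆ T : #Q = t − 1, d + Q ∈ W}` (`t`-sets). [this work] -/
theorem card_WC1_le_T {t : ℕ} (ht : 1 ≤ t) {m : α →₀ ℕ} (hm : ∀ i, m i ≤ 2) (W : Finset (Finset α)) (hW : ∀ w ∈ W, #w = t) :
    #((W.filter fun w => ind w ≤ m).filter fun w => #(dbl m ∩ w) = 1) ≤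
      ∑ d ∈ dbl m, #(((lev m 1).powersetCard (t - 1)).filter fun Q => insert d Q ∈ W) := by
  set WC := (W.filter fun w => ind w ≤ m).filter fun w => #(dbl m ∩ w) = 1
  set Dom := (dbl m ×ˢ (lev m 1).powersetCard (t - 1)).filter fun q => insert q.1 q.2 ∈ W
  have h1 : #WC ≤ #Dom := by
    refine card_le_card_of_surjOn (fun q => insert q.1 q.2) fun w hw => ?_
    obtain ⟨hw', hDw⟩ := mem_filter.1 (Finset.mem_coe.1 hw)
    obtain ⟨hwW, hwm⟩ := mem_filter.1 hw'
    have hwsupp : w ⊆ dbl m ∪ lev m 1 := support_eq_dbl_union_lev hm ▸ (SahiAllButC.ind_le_iff_subset_support _ _).1 hwm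
    obtain ⟨d, hd⟩ := card_eq_one.1 hDw
    have hdw : d ∈ dbl m ∩ w := by rw [hd]; exact mem_singleton_self d
    have hQ : w \ dbl m ⊆ lev m 1 := fun y hy => (mem_union.1 (hwsupp (mem_sdiff.1 hy).1)).resolve_left (mem_sdiff.1 hy).2
    have hQ2 : #(w \ dbl m) = t - 1 := by
      have := card_sdiff_add_card_inter w (dbl m); rw [inter_comm, hDw, hW w hwW] at this; omega
    have heq : insert d (w \ dbl m) = w := by
      ext i; simp only [mem_insert, mem_sdiff]
      constructor
      · rintro (rfl | ⟨hi, _⟩)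
        · exact (mem_inter.1 hdw).2
        · exact hi
      · intro hi
        by_cases hiD : i ∈ dbl m
        · have : i ∈ dbl m ∩ w := mem_inter.2 ⟨hiD, hi⟩
          rw [hd, mem_singleton] at this; exact Or.inl this
        · exact Or.inr ⟨hi, hiD⟩
    refine ⟨(d, w \ dbl m), Finset.mem_coe.2 (mem_filter.2 ⟨mem_product.2 ⟨(mem_inter.1 hdw).1, mem_powersetCard.2 ⟨hQ, hQ2⟩⟩, ?_⟩), heq⟩
    show insert d (w \ dbl m) ∈ W
    rw [heq]; exact hwW
  refine h1.trans (le_of_eq ?_)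
  rw [card_filter, sum_product]
  refine sum_congr rfl fun d _ => ?_
  rw [card_filter]

/-- **Charge of the row `#dbl = 2` of `(L_t)`** (`t ≥ 2`, `τ ≥ t`). [this work] -/
theorem coeff_chargeT_rowTwoT_le {t : ℕ} (ht : 2 ≤ t) {m : α →₀ ℕ} (hm : ∀ i, m i ≤ 2) (hD : #(dbl m) = 2) (hτ : t ≤ #(lev m 1))
    (W : Finset (Finset α)) (hW : ∀ w ∈ W, #w = t) :
    (gf (bySize (· ≤ t - 1) : Finset (Finset α)) * gf (bySize (t ≤ ·) : Finset (Finset α)) * gf W).coeff m ≤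
      (cH t (#(lev m 1) - t + 4) : ℤ) * #(((lev m 1).powersetCard (t - 2)).filter fun Y => dbl m ∪ Y ∈ W) +
        (cH (t - 1) (#(lev m 1) - t + 2) : ℤ) * ∑ d ∈ dbl m, #(((lev m 1).powersetCard (t - 1)).filter fun Q => insert d Q ∈ W) +
        (cH (t - 2) (#(lev m 1) - t) : ℤ) * #(((lev m 1).powersetCard t).filter fun E => E ∈ W) := by
  rw [coeff_chargeT_eq_sum]
  set Wm := W.filter fun w => ind w ≤ m
  have hDT : Disjoint (dbl m) (lev m 1) := disjoint_dbl_lev_one m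
  have hval : ∀ w ∈ Wm, (gf (bySize (· ≤ t - 1) : Finset (Finset α)) * gf (bySize (t ≤ ·) : Finset (Finset α))).coeff (m - ind w) =
      (if #(dbl m ∩ w) = 2 then (cH t (#(lev m 1) - t + 4) : ℤ) else 0) + (if #(dbl m ∩ w) = 1 then (cH (t - 1) (#(lev m 1) - t + 2) : ℤ) else 0) +
        (if #(dbl m ∩ w) = 0 then (cH (t - 2) (#(lev m 1) - t) : ℤ) else 0) := fun w hw => by
    obtain ⟨hwW, hwm⟩ := mem_filter.1 hw
    have hwt := hW w hwW
    rw [coeff_thetaT_mul_atLeastT_eq_cH (by omega) (sub_ind_le_two_of_le_two hm w), dbl_sub_ind_of_le_two hm, sgl_sub_ind_of_le_two hm]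
    have hsd : #(dbl m \ w) + #(dbl m ∩ w) = 2 := by rw [card_sdiff_add_card_inter, hD]
    have hcu : #(dbl m ∩ w ∪ lev m 1 \ w) = #(dbl m ∩ w) + #(lev m 1 \ w) :=
      card_union_of_disjoint (Disjoint.mono inter_subset_left sdiff_subset hDT)
    have hTw : #(lev m 1 \ w) + #(lev m 1 ∩ w) = #(lev m 1) := card_sdiff_add_card_inter _ _
    have hwsupp : w ⊆ dbl m ∪ lev m 1 := by
      rw [← support_eq_dbl_union_lev hm]; exact (SahiAllButC.ind_le_iff_subset_support _ _).1 hwm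
    have hsplit : #(dbl m ∩ w) + #(lev m 1 ∩ w) = t := by
      rw [← card_union_of_disjoint (Disjoint.mono inter_subset_left inter_subset_left hDT), ← union_inter_distrib_right,
        inter_eq_right.2 hwsupp, hwt]
    have hle : #(dbl m ∩ w) ≤ 2 := by have := card_le_card (inter_subset_left (s₁ := dbl m) (s₂ := w)); omega
    interval_cases h : #(dbl m ∩ w)
    · simp only [if_neg (by norm_num : ¬(0:ℕ) = 2), if_neg (by norm_num : ¬(0:ℕ) = 1), if_true, zero_add]
      rw [show t - #(dbl m \ w) = t - 2 from by omega, hcu]; congr 2; omega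
    · simp only [if_neg (by norm_num : ¬(1:ℕ) = 2), if_true, if_neg (by norm_num : ¬(1:ℕ) = 0), zero_add, add_zero]
      rw [show t - #(dbl m \ w) = t - 1 from by omega, hcu]; congr 2; omega
    · simp only [if_true, if_neg (by norm_num : ¬(2:ℕ) = 1), if_neg (by norm_num : ¬(2:ℕ) = 0), add_zero]
      rw [show t - #(dbl m \ w) = t from by omega, hcu]; congr 2; omega
  rw [sum_congr rfl hval, sum_add_distrib, sum_add_distrib]
  have e2 : ∑ w ∈ Wm, (if #(dbl m ∩ w) = 2 then (cH t (#(lev m 1) - t + 4) : ℤ) else 0) =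
      (cH t (#(lev m 1) - t + 4) : ℤ) * #(Wm.filter fun w => #(dbl m ∩ w) = 2) := by
    rw [← sum_filter, sum_const, nsmul_eq_mul, mul_comm]
  have e1 : ∑ w ∈ Wm, (if #(dbl m ∩ w) = 1 then (cH (t - 1) (#(lev m 1) - t + 2) : ℤ) else 0) =
      (cH (t - 1) (#(lev m 1) - t + 2) : ℤ) * #(Wm.filter fun w => #(dbl m ∩ w) = 1) := by
    rw [← sum_filter, sum_const, nsmul_eq_mul, mul_comm]
  have e0 : ∑ w ∈ Wm, (if #(dbl m ∩ w) = 0 then (cH (t - 2) (#(lev m 1) - t) : ℤ) else 0) =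
      (cH (t - 2) (#(lev m 1) - t) : ℤ) * #(Wm.filter fun w => #(dbl m ∩ w) = 0) := by
    rw [← sum_filter, sum_const, nsmul_eq_mul, mul_comm]
  rw [e2, e1, e0]
  have c2 := card_WC2_le_T (t := t) hm hD W hW
  have c1 := card_WC1_le_T (t := t) (by omega) hm W hW
  have c0 : #(Wm.filter fun w => #(dbl m ∩ w) = 0) ≤ #(((lev m 1).powersetCard t).filter fun E => E ∈ W) := by
    refine card_le_card fun w hw => ?_
    obtain ⟨hw, h0⟩ := mem_filter.1 hw
    obtain ⟨hwW, hwm⟩ := mem_filter.1 hw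
    have hwsupp : w ⊆ dbl m ∪ lev m 1 := by
      rw [← support_eq_dbl_union_lev hm]; exact (SahiAllButC.ind_le_iff_subset_support _ _).1 hwm
    refine mem_filter.2 ⟨mem_powersetCard.2 ⟨fun i hi => ?_, hW w hwW⟩, hwW⟩
    rcases mem_union.1 (hwsupp hi) with h | h
    · have : i ∈ dbl m ∩ w := mem_inter.2 ⟨h, hi⟩
      rw [card_eq_zero.1 h0] at this; exact absurd this (notMem_empty i)
    · exact h
  have p3 : (0 : ℤ) ≤ cH t (#(lev m 1) - t + 4) := Nat.cast_nonneg _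
  have p2 : (0 : ℤ) ≤ cH (t - 1) (#(lev m 1) - t + 2) := Nat.cast_nonneg _
  have p1 : (0 : ℤ) ≤ cH (t - 2) (#(lev m 1) - t) := Nat.cast_nonneg _
  have c2' : (#(Wm.filter fun w => #(dbl m ∩ w) = 2) : ℤ) ≤ #(((lev m 1).powersetCard (t - 2)).filter fun Y => dbl m ∪ Y ∈ W) := by
    exact_mod_cast c2
  have c1' : (#(Wm.filter fun w => #(dbl m ∩ w) = 1) : ℤ) ≤
      ∑ d ∈ dbl m, (#(((lev m 1).powersetCard (t - 1)).filter fun Q => insert d Q ∈ W) : ℤ) := by exact_mod_cast c1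
  have c0' : (#(Wm.filter fun w => #(dbl m ∩ w) = 0) : ℤ) ≤ #(((lev m 1).powersetCard t).filter fun E => E ∈ W) := by
    exact_mod_cast c0
  push_cast
  nlinarith [mul_le_mul_of_nonneg_left c2' p3, mul_le_mul_of_nonneg_left c1' p2, mul_le_mul_of_nonneg_left c0' p1]

omit [Fintype α] in
/-- Pinned kinds of a restriction cube `D ∪ s` at `d` (`D = {d, d'}`): the `a`-sets `D ∪ Y` and the `d`-sets `d ∪ Q` inside. [this work] -/
theorem card_pinned_kinds_le {t : ℕ} (ht : 2 ≤ t) {T s D : Finset α} {d d' : α} (hDe : D = {d, d'}) (hdd' : d ≠ d') (hdT : d ∉ T) (hd'T : d' ∉ T) :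
    #((((T.powersetCard (t - 2)).filter fun Y => D ∪ Y ∈ 𝒳 ∧ D ∪ Y ∈ 𝒵)).filter fun w => w ⊆ s)
      + #((((T.powersetCard (t - 1)).filter fun Q => insert d Q ∈ 𝒳 ∧ insert d Q ∈ 𝒵)).filter fun w => w ⊆ s)
      ≤ #((csetsT 𝒳 𝒵 ∅ (D ∪ s) t).filter fun w => d ∈ w) := by
  rw [← card_filter_add_card_filter_not (s := (csetsT 𝒳 𝒵 ∅ (D ∪ s) t).filter fun w => d ∈ w) (fun w => d' ∈ w)]
  refine add_le_add ?_ ?_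
  · refine card_le_card_of_injOn (fun Y => D ∪ Y) (fun Y hY => ?_) (fun Y hY Y' hY' h => ?_)
    · obtain ⟨hYA, hYs⟩ := mem_filter.1 (Finset.mem_coe.1 hY)
      obtain ⟨hY1, hX, hZ⟩ := mem_filter.1 hYA
      obtain ⟨hYT, hYc⟩ := mem_powersetCard.1 hY1
      have hDY : Disjoint D Y := by
        rw [hDe, disjoint_insert_left, disjoint_singleton_left]; exact ⟨fun h => hdT (hYT h), fun h => hd'T (hYT h)⟩
      refine Finset.mem_coe.2 (mem_filter.2 ⟨mem_filter.2 ⟨mem_csetsT.2 ⟨union_subset_union Subset.rfl hYs, ?_, ?_, ?_⟩, ?_⟩, ?_⟩)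
      · rw [card_union_of_disjoint hDY, hDe, card_pair hdd', hYc]; omega
      · rw [empty_union]; exact hX
      · rw [empty_union]; exact hZ
      · exact mem_union_left _ (by rw [hDe]; simp)
      · exact mem_union_left _ (by rw [hDe]; simp)
    · have hYT := (mem_powersetCard.1 (mem_filter.1 (mem_filter.1 (Finset.mem_coe.1 hY)).1).1).1
      have hYT' := (mem_powersetCard.1 (mem_filter.1 (mem_filter.1 (Finset.mem_coe.1 hY')).1).1).1
      have hDY : Disjoint Y D := by
        rw [hDe, disjoint_insert_right, disjoint_singleton_right]; exact ⟨fun h => hdT (hYT h), fun h => hd'T (hYT h)⟩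
      have hDY' : Disjoint Y' D := by
        rw [hDe, disjoint_insert_right, disjoint_singleton_right]; exact ⟨fun h => hdT (hYT' h), fun h => hd'T (hYT' h)⟩
      have e : (D ∪ Y) \ D = (D ∪ Y') \ D := by rw [show D ∪ Y = D ∪ Y' from h]
      rwa [union_sdiff_left, union_sdiff_left, sdiff_eq_self_of_disjoint hDY, sdiff_eq_self_of_disjoint hDY'] at e
  · refine card_le_card_of_injOn (fun Q => insert d Q) (fun Q hQ => ?_) (fun Q hQ Q' hQ' h => ?_)
    · obtain ⟨hQG, hQs⟩ := mem_filter.1 (Finset.mem_coe.1 hQ)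
      obtain ⟨hQ2, hX, hZ⟩ := mem_filter.1 hQG
      obtain ⟨hQT, hQc⟩ := mem_powersetCard.1 hQ2
      refine Finset.mem_coe.2 (mem_filter.2 ⟨mem_filter.2 ⟨mem_csetsT.2 ⟨?_, ?_, ?_, ?_⟩, mem_insert_self d Q⟩, ?_⟩)
      · exact insert_subset (mem_union_left _ (by rw [hDe]; simp)) (hQs.trans subset_union_right)
      · rw [card_insert_of_notMem (fun h => hdT (hQT h)), hQc]; omega
      · rw [empty_union]; exact hX
      · rw [empty_union]; exact hZ
      · rw [mem_insert, not_or]; exact ⟨hdd'.symm, fun h => hd'T (hQT h)⟩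
    · have hQT := (mem_powersetCard.1 (mem_filter.1 (mem_filter.1 (Finset.mem_coe.1 hQ)).1).1).1
      have hQT' := (mem_powersetCard.1 (mem_filter.1 (mem_filter.1 (Finset.mem_coe.1 hQ')).1).1).1
      have h' : insert d Q = insert d Q' := h
      rw [← erase_insert (fun h => hdT (hQT h)), h', erase_insert (fun h => hdT (hQT' h))]

omit [Fintype α] in
/-- Unpinned kinds of a restriction cube `D ∪ s` at `d` (`D = {d, d'}`): the `d'`-sets `d' ∪ Q` and the `T`-sets `E` inside. [this work] -/
theorem card_unpinned_kinds_le {t : ℕ} (ht : 2 ≤ t) {T s D : Finset α} {d d' : α} (hDe : D = {d, d'}) (hdd' : d ≠ d') (hdT : d ∉ T) (hd'T : d' ∉ T) :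
    #((((T.powersetCard (t - 1)).filter fun Q => insert d' Q ∈ 𝒳 ∧ insert d' Q ∈ 𝒵)).filter fun w => w ⊆ s)
      + #((((T.powersetCard t).filter fun E => E ∈ 𝒳 ∧ E ∈ 𝒵)).filter fun w => w ⊆ s)
      ≤ #((csetsT 𝒳 𝒵 ∅ (D ∪ s) t).filter fun w => d ∉ w) := by
  rw [← card_filter_add_card_filter_not (s := (csetsT 𝒳 𝒵 ∅ (D ∪ s) t).filter fun w => d ∉ w) (fun w => d' ∈ w)]
  refine add_le_add ?_ ?_
  · refine card_le_card_of_injOn (fun Q => insert d' Q) (fun Q hQ => ?_) (fun Q hQ Q' hQ' h => ?_)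
    · obtain ⟨hQG, hQs⟩ := mem_filter.1 (Finset.mem_coe.1 hQ)
      obtain ⟨hQ2, hX, hZ⟩ := mem_filter.1 hQG
      obtain ⟨hQT, hQc⟩ := mem_powersetCard.1 hQ2
      refine Finset.mem_coe.2 (mem_filter.2 ⟨mem_filter.2 ⟨mem_csetsT.2 ⟨?_, ?_, ?_, ?_⟩, ?_⟩, mem_insert_self d' Q⟩)
      · exact insert_subset (mem_union_left _ (by rw [hDe]; simp)) (hQs.trans subset_union_right)
      · rw [card_insert_of_notMem (fun h => hd'T (hQT h)), hQc]; omega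
      · rw [empty_union]; exact hX
      · rw [empty_union]; exact hZ
      · rw [mem_insert, not_or]; exact ⟨hdd', fun h => hdT (hQT h)⟩
    · have hQT := (mem_powersetCard.1 (mem_filter.1 (mem_filter.1 (Finset.mem_coe.1 hQ)).1).1).1
      have hQT' := (mem_powersetCard.1 (mem_filter.1 (mem_filter.1 (Finset.mem_coe.1 hQ')).1).1).1
      have h' : insert d' Q = insert d' Q' := h
      rw [← erase_insert (fun h => hd'T (hQT h)), h', erase_insert (fun h => hd'T (hQT' h))]
  · refine card_le_card fun E hE => ?_
    obtain ⟨hEE, hEs⟩ := mem_filter.1 hE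
    obtain ⟨hE3, hX, hZ⟩ := mem_filter.1 hEE
    obtain ⟨hET', hEc⟩ := mem_powersetCard.1 hE3
    refine mem_filter.2 ⟨mem_filter.2 ⟨mem_csetsT.2 ⟨hEs.trans subset_union_right, hEc, ?_, ?_⟩, fun h => hdT (hET' h)⟩,
      fun h => hd'T (hET' h)⟩
    · rw [empty_union]; exact hX
    · rw [empty_union]; exact hZ

omit [Fintype α] in
/-- All four kinds inside a restriction cube are common `t`-sets of it. [this work] -/
theorem card_kinds_le_csetsT {t : ℕ} (ht : 2 ≤ t) {T s D : Finset α} {d d' : α} (hDe : D = {d, d'}) (hdd' : d ≠ d') (hdT : d ∉ T)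
    (hd'T : d' ∉ T) :
    #((((T.powersetCard (t - 2)).filter fun Y => D ∪ Y ∈ 𝒳 ∧ D ∪ Y ∈ 𝒵)).filter fun w => w ⊆ s)
      + #((((T.powersetCard (t - 1)).filter fun Q => insert d Q ∈ 𝒳 ∧ insert d Q ∈ 𝒵)).filter fun w => w ⊆ s)
      + #((((T.powersetCard (t - 1)).filter fun Q => insert d' Q ∈ 𝒳 ∧ insert d' Q ∈ 𝒵)).filter fun w => w ⊆ s)
      + #((((T.powersetCard t).filter fun E => E ∈ 𝒳 ∧ E ∈ 𝒵)).filter fun w => w ⊆ s)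
      ≤ #(csetsT 𝒳 𝒵 ∅ (D ∪ s) t) := by
  have h1 := card_pinned_kinds_le (𝒳 := 𝒳) (𝒵 := 𝒵) (s := s) ht hDe hdd' hdT hd'T
  have h2 := card_unpinned_kinds_le (𝒳 := 𝒳) (𝒵 := 𝒵) (s := s) ht hDe hdd' hdT hd'T
  have h3 := card_filter_add_card_filter_not (s := csetsT 𝒳 𝒵 ∅ (D ∪ s) t) (fun w => d ∈ w)
  omega

end RowTwoT

end Summit.CriticalPhenomena.PercolationContinuityZ3.Theorems.SahiCTCForms
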